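import Literature.MathematicalPhysics.QuantumFieldTheory.Balaban1983to89.B9Thm311TwistPureGaugeZd
import Literature.MathematicalPhysics.QuantumFieldTheory.Balaban1983to89.B9Eq321ProjectorKernelZd
import Literature.MathematicalPhysics.QuantumFieldTheory.Balaban1983to89.B9SupplySockB9P3ZdAtHerm

/-!
# `Balaban1983to89.B9Thm311SingularInFrameClassCubeZd` — [Balaban1985BackgroundPropagators] Thm 3.11 p. 416 ∕ (3.27) p. 395 vs. (3.35) p. 396 AT A CUBE MEMBER OF THE `ℤᵈ`
# FRAME: THE FRAME CLASS HOLDS A SINGULAR BACKGROUND — the kernel certificate of dag-n06-b g20's LOCATED-SELF-6, strong form: inside the class (3.35) of every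
# `cubeFam false` member there is a unitary `U₀` (the crossing-bond twist) and a Hermitian pure gauge `0 ≠ A = D_{U₀}λ ∈ E_𝔤(□₀)` with `Δ_a(U₀)A = 0` for the
# genuine four-letter record `opsAllZd`; hence `¬ RegularAtH` there (`G_𝔤(U₀)` reads its junk branch `0`), the frame-keyed Theorem 3.11 regularity binder
# `RegularInClassAtH` and the frame-keyed (3.27) binder EDITION H `InvAtH` are FALSE for the genuine record at cube members

statement-level skeleton of published theorems with citation tags; proofs where landed; nothing here is a claim about the
Yang–Mills mass gap

`[Balaban1985BackgroundPropagators]` ("B9", CMP **99** (1985) 389–434; journal page = PDF page + 388): Thm 3.11 p. 416 «Let us assume that U satisfies the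
condition (3.35). Then the operators Δ′_a, G′, (Q′G′²Q′*)⁻¹, Δ_a, G are positive definite»; (3.27) p. 395 «G(U) = G = (Δ_a↾Ω₀)⁻¹» and p. 394 «It will be proved
later (Theorem 3.11) with the restrictions on U described below»; (3.35) p. 396 (the class: a gauge on each cube `□ ⊂ Bʲ(Λ_j) ∪ B^{j+1}(Λ_{j+1})`); (3.21) p. 394;
p. 418 («A → A − Dλ»).  `[Balaban1985RegularSpaces]` ("B8"): (1.7) p. 77 (plaquettes TOUCHING `Ω_j`), (1.33) p. 82, (1.58) p. 86 (the (3.27) reading «A′ = G(U₀)J»),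
(1.131) p. 99 (the cubes), (1.68) p. 88.  PDF held: `paper:balaban1985-cmp99-background-propagators` pp. 394–396, 416–418.

CITATION HEADER ∕ WHY THIS FILE (cell `pub-ymgap`, HUMAN RULING D-0062 ∕ D-0149; width seat `pub-ymgap-dag-n06-w3` (g5), node N06 = [B9]; CLAIM-2 file 3∕3;
count-neutral).  dag-n06-b g20 LOCATED (LOCATED-SELF-6, bus 2026-08-28 08:19Z) that the frame's class (3.35) at a cube member — (3.35) on the class cubes
`cubeClass396Zd ⊆ Ω₀ = □₀` — «cannot see the collar», so «a Reg335-keyed `PosDefInClassAtH` ∕ `InvAtH` speaks about backgrounds print never feeds to (3.27)»,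
and RE-KEYED the junction's binders to the datum's class (1.7) (EDITION H·I `InvAtHI`, `B9SupplySockB9P3ZdAtHermInAk`; EDITION U; inhabited per member).  What was
missing is the kernel certificate that the frame-keyed binders are actually FALSE for the genuine record — dag-n06-b g18's skew pure gauges
(`B9SupplySockB9P3ZdSkewGaugeMode`) refute only the `𝔸`-valued editions (`InvAt`, `RegularAt`, `PosDefInClassAt`), since Hermitian fields exclude them.
THIS file gives it for the HERMITIAN editions: at the crossing-bond twist `U₀` of this seat's CLAIM-1 (in the class by collar blindness,
`B9Thm311IndefiniteInFrameClassCubeZd.reg335_bgZd_of_one_on_omega`) the Hermitian pure gauge `D_{U₀}λ` of file 2∕3's `λ` (`R(U₀)(𝟙Δλ) = 0`, `λ ≠ 0`, available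
because the lower corner of `□₀` is a level-`0` constraint site, §2) is killed by all four genuine letters (file 1∕3) and is non-zero (§1: along a lattice ray a
flat-constant `λ` would leave its finite support); a non-zero kernel vector excludes `RegularAtH` (§1), and (3.27) would return both `A` and `0` as `G(U₀)0`.

WHAT IS PROVED (kernel, 0 sorry; theorems only — no `def`, `instance`, `notation`).
* §1 (the twist of `B9Eq310TwistedBondDstarDZd`, hypothesis `hU`) ★ `twist_not_inAk` (the witness MISSES the datum class (1.7) for every `α₀ < 2`), `gauge_ne_zero` (`λ ≠ 0` with finite support ⟹ `D_{U₀}λ ≠ 0`), `gauge_mem_domSubH`, `onDom_gauge`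
  (the binders' `OnDom`), ★ `not_regularAtH_of_kernel` (GENERIC: a non-zero `A ∈ E_𝔤(Ω₀)` with `Δ_a(U₀)A = 0` excludes `RegularAtH`, any letters), ★★★ `exists_kernel_twist`
  (member with finite `Ω₀ ∌ z`, `z + e_ν ∈ Ω₀`, a constraint site `y₀ ∈ Ω₀ ∩ Λ₀`, `L ≥ 1`, a direction `κ ≠ ν`: a Hermitian `0 ≠ A ∈ E_𝔤(Ω₀)` with `OnDom`,
  `Δ_a(U₀)A = 0` and `Δ_a(U₀)0 = 0`), ★★★ `not_regularAtH_twist`.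
* §2 (cube members `Ω = cubeFam false …`, `Λs = cubeLamS …`, `2 ≤ d`, `1 ≤ L`, `1 ≤ ρ`; `𝔸 : Type`, faithful Hermitian `τ`) ★ `corner_mem_cubeLamS_zero` (`sqLo₀ ∈ Λ₀`),
  ★★★ `exists_reg335_not_regularAtH_cube` (for every `c35·M·α₀ > 0`: a unitary `U₀` IN the frame class with `¬ RegularAtH` and the kernel vector),
  ★★★ `not_regularInClassAtH_opsAllZd_cube`, ★★★ `not_invAtH_withGopZdH_opsAllZd_cube` (EDITION H over the genuine `G_𝔤`: FALSE),
  ★★ `not_invAtH_opsAllZd_cube` (EDITION H over `gopZd`: FALSE), ★★ `not_regularInClassAt_not_invAt_opsAllZd_cube` (the `𝔸`-valued `RegularInClassAt` and the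
  (3.27) binder OF RECORD `InvAt`: FALSE at every cube member, incl. `m = 0`) — all for `0 < c35`, `0 < M`, `0 < a₃`; ★ `not_regularAt_of_kernel` (generic, `E(Ω₀)`).

HONEST SCOPE.  A located NEGATIVE about a TYPING (class MISSTATED: frame-keyed (3.35) at a cube member vs print's covering convention), the repaired datum-keyed binders already in tree (dag-n06-b `InvAtHI` ∕ EDITION U, this seat's g4 `…TouchingClassOfCoerciveZd`); it does NOT contradict [B9] Thm 3.11; no estimate of [B9]; count-neutral helper of K1⁹ (`--supports stmt-QuantumFields-27364`); N05 ∕ N06 NOT discharged; K1⁹ NOT closed;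
one finite `𝕋⁴` programme at fixed `ε`, Bałaban as printed; R4 closes only the conditional finite-`𝕋⁴` rung `BalabanLadder.UV` — nothing continuum ∕ `ℝ⁴` ∕ OS ∕
mass gap ∕ Clay.  Unit `pub-ymgap-dag-n06-w3` (g5), 2026-08-28.
-/

noncomputable section

open scoped BigOperators
open NormedSpace Complex

namespace Literature.MathematicalPhysics.QuantumFieldTheory.Balaban1983to89.B9Thm311SingularInFrameClassCubeZd

open B7Prop1Explicit (e)
open B7Prop2Explicit (unitaryUnits)
open B7Eq78Linearization (conjR QprimeIter_zero)
open B8Ineq132 (PlaqTouches BondTouches plaqF covDeriv covDerivFwd)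
open B8Eq138LandauZd (covDivB covLap)
open B8Eq133Hypotheses (shiftT byDir byDir_apply)
open B8Eq131Cubes (sqLo sqHi inLo inHi)
open B8Eq131CubesAdmissible (cubeFam cubeFam_false_zero)
open B8CubeMemberZd (cubeLamS cubeLam)
open B8Ineq159FlatCubeMemberKernel (mem_cube_zero_iff)
open B8LeafModelZd (ZdIdx)
open B8Eq155JBound (Jcur)
open B8Eq146AExpansion (plaqCovDeriv)
open B8Eq143PlaqExpansion (pdiv)
open B8ScaledSupNorm (weight Bdd weight_nonneg)
open B9SupplySockB9P3ZdFrame (bgZd memZd ιCfgZd)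
open B9SupplySockB9P3ZdLetters (OpsZd deltaAOf)
open B9SupplySockB9P3ZdLettersOmega (OnDom restrictDom restrictDom_of restrictDom_of_not)
open B9SupplySockB9P3ZdAllLettersZd (opsAllZd)
open B9SupplySockB9P3ZdAtHerm (InvAtH)
open B9Eq321LandauProjectionZd (suppSub gaugeNull rangeGen rangeSub projE projR indicator_mem_suppSub projE_apply_mem_range)
open B9Eq327GreenZd (domSub)
open B9Eq327GreenZdHerm (domSubH RegularAtH RegularInClassAtH withGopZdH deltaAOf_withGopZdH)
open B9Eq37Insertion (imC)
open B9Eq39Adjoint (R covD covDstar curl plaqU divP R_zero)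
open B9Eq310Hermitian (yP jordanF commG₁ commG₂ commG₃ commG₄ divL deltaPrimeOp)
open B9Eq369CurvSmallZd (DpZd shiftT_symm_apply)
open B9Thm311PerMemberCubeZdTouching (sqLo_le_sqHi_zero)
open B9Eq310TwistedBondDstarDZd B9Eq310TwistedBondDeltaPrimeZd B9Thm311IndefiniteInFrameClassCubeZd
open B9Thm311TwistPureGaugeZd B9Eq321ProjectorKernelZd

export B7Prop1Explicit (Site)

variable {d : ℕ}

/-! ## §1  The pure gauge of such a `λ` is a non-zero Hermitian field of `E_𝔤(Ω₀)`, hence a KERNEL VECTOR: `¬ RegularAtH` -/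

section Singular

variable {𝔸 : Type*} [CStarAlgebra 𝔸]
variable (z : Site d) (ν : Fin d) (η : ℝ)
variable {U₀ : Site d → Fin d → 𝔸ˣ} (hU : ∀ y κ, U₀ y κ = if y = z ∧ κ = ν then -1 else 1)

include hU in
/-- at the twist, the pure gauge of a non-zero `λ` supported in a FINITE set is non-zero (`η ≠ 0`): along the ray `x + n·e_ν` a constant non-zero `λ` would
leave the support. [cite: Balaban1985BackgroundPropagators, (3.3) p.391, p.418] -/
theorem gauge_ne_zero (hη : η ≠ 0) {s : Finset (Site d)} {lam : Site d → 𝔸} (hsupp : ∀ x, x ∉ s → lam x = 0) (hlam : lam ≠ 0) :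
    (fun y κ => covDerivFwd η U₀ κ lam y) ≠ 0 := by
  intro hA
  have hstep : ∀ y : Site d, lam (y + e ν) = lam y := by
    intro y
    have h := congrFun (congrFun hA y) ν
    rw [covDerivFwd_twist z ν η hU, Pi.zero_apply, Pi.zero_apply, smul_eq_zero] at h
    rcases h with h | h
    · exact absurd h (inv_ne_zero hη)
    · exact (sub_eq_zero.mp h)
  obtain ⟨x, hx⟩ : ∃ x, lam x ≠ 0 := Function.ne_iff.mp hlam
  have hray : ∀ n : ℕ, lam (x + n • e ν) = lam x := by
    intro n
    induction n with
    | zero => rw [zero_smul, add_zero]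
    | succ k ih => rw [add_smul, one_smul, ← add_assoc, hstep, ih]
  have hmem : ∀ n : ℕ, x + n • e ν ∈ (↑s : Set (Site d)) := by
    intro n
    by_contra hn
    exact hx (by rw [← hray n]; exact hsupp _ hn)
  have hinj : Function.Injective fun n : ℕ => x + n • e ν := by
    intro n n' h
    have h' := congrArg (fun v => v ν) h
    simp [B7Prop1Explicit.e_apply] at h'
    exact_mod_cast h'
  exact (Set.infinite_of_injective_forall_mem hinj hmem) s.finite_toSet

include hU in
/-- the pure gauge of a Hermitian `λ` supported in `Ω₀` lies in `E_𝔤(Ω₀)` (at the twist the transports are trivial). [cite: Balaban1985BackgroundPropagators, p.391, (3.27) p.395] -/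
theorem gauge_mem_domSubH {Ω₀ : Set (Site d)} {lam : Site d → 𝔸} (hsa : ∀ x, IsSelfAdjoint (lam x)) (hsupp : ∀ x, x ∉ Ω₀ → lam x = 0) :
    (fun y κ => covDerivFwd η U₀ κ lam y) ∈ domSubH (𝔸 := 𝔸) Ω₀ := by
  refine ⟨fun y κ hb => ?_, fun y κ => ?_⟩
  · simp only [BondTouches, not_or] at hb
    show covDerivFwd η U₀ κ lam y = 0
    rw [covDerivFwd_twist z ν η hU, hsupp _ hb.1, hsupp _ hb.2, sub_zero, smul_zero]
  · show IsSelfAdjoint (covDerivFwd η U₀ κ lam y)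
    rw [covDerivFwd_twist z ν η hU, IsSelfAdjoint, star_smul, star_trivial, star_sub, (hsa _).star_eq, (hsa _).star_eq]

include hU in
/-- … and satisfies the binders' `OnDom` (support clause + bounded weighted family: the field is finitely supported).
[cite: Balaban1985BackgroundPropagators, (3.27) p.395, (3.41) p.397; Balaban1985RegularSpaces, p.86] -/
theorem onDom_gauge {L : ℕ} (hL : 1 ≤ L) (m : ℕ) (hη : 0 < η) {Ω : ℕ → Set (Site d)} {s : Finset (Site d)} (hs : ∀ x, x ∈ Ω 0 ↔ x ∈ s)
    {lam : Site d → 𝔸} (hsa : ∀ x, IsSelfAdjoint (lam x)) (hsupp : ∀ x, x ∉ s → lam x = 0) :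
    OnDom L m η Ω (fun y κ => covDerivFwd η U₀ κ lam y) := by
  have hΛ : ∀ x, ‖lam x‖ ≤ ∑ y ∈ s, ‖lam y‖ := by
    intro x
    by_cases hx : x ∈ s
    · exact Finset.single_le_sum (fun y _ => norm_nonneg (lam y)) hx
    · rw [hsupp x hx, norm_zero]; exact Finset.sum_nonneg fun y _ => norm_nonneg _
  refine ⟨(gauge_mem_domSubH z ν η hU hsa fun x hx => hsupp x (fun h => hx ((hs x).mpr h))).1,
    weight L η (-(1 : ℝ)) m * (‖η⁻¹‖ * ((∑ y ∈ s, ‖lam y‖) + ∑ y ∈ s, ‖lam y‖)), fun j hj b _ => ?_⟩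
  refine mul_le_mul (B9SupplySockB9P3ZdAtBoundaryMode.weight_negOne_mono hL hη.le hj) ?_ (norm_nonneg _) (weight_nonneg L hη.le _ _)
  show ‖covDerivFwd η U₀ b.2 lam b.1‖ ≤ _
  rw [covDerivFwd_twist z ν η hU, norm_smul]
  exact mul_le_mul_of_nonneg_left ((norm_sub_le _ _).trans (add_le_add (hΛ _) (hΛ _))) (norm_nonneg _)

omit hU in
/-- `‖(−1) − 1‖ = 2` (the maximum of `‖W − 1‖` over unitaries). [cite: Balaban1985RegularSpaces, (1.7) p.77 (bookkeeping)] -/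
private theorem norm_neg_one_sub_one' [Nontrivial 𝔸] : ‖(-1 : 𝔸) - 1‖ = 2 := by
  have h : (-1 : 𝔸) - 1 = -((2 : ℝ) • (1 : 𝔸)) := by rw [two_smul]; abel
  rw [h, norm_neg, norm_smul, norm_one, mul_one, Real.norm_eq_abs, abs_of_pos (by norm_num : (0 : ℝ) < 2)]

include hU in
/-- ★ **THE WITNESS MISSES THE REPAIRED (DATUM-KEYED) CLASS**: the twist is NOT in [B8]'s class `𝔄_m({Ω_j}, α₀)` (`InAk`) of any domain sequence whose `Ω₀` contains
the far end of the twisted bond, for every `α₀ < 2` — so the datum-keyed binders (dag-n06-b's EDITION H·I `InvAtHI` ∕ EDITION U, this lineage's g4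
`…TouchingClassOfCoerciveZd`) are untouched by the negatives below (class MISSTATED, not theorem false). [cite: Balaban1985RegularSpaces, (1.7) p.77, (1.33) p.82; Balaban1985BackgroundPropagators, (3.35) p.396] -/
theorem twist_not_inAk [Nontrivial 𝔸] {L m : ℕ} {Ω : ℕ → Set (Site d)} (hx₀ : z + e ν ∈ Ω 0) {κ : Fin d} (hκ : κ ≠ ν) {α₀ : ℝ} (hα₀ : α₀ < 2) :
    ¬ B8Ineq132.InAk L m η α₀ Ω U₀ := by
  intro h
  have h1 := B9Thm311PerMemberCubeZdTouching.plaq_le_of_inAk h z κ ν hκ (Or.inr (Or.inr (Or.inl hx₀)))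
  rw [plaqF_twist_at z ν hU hκ, norm_neg_one_sub_one'] at h1
  linarith

omit hU in
/-- ★ **A NON-ZERO KERNEL VECTOR ON `E_𝔤(Ω₀)` EXCLUDES `RegularAtH`** (Theorem 3.11's invertibility conclusion (3.27) at `U₀`): if `Δ_a(U₀)A = 0` for some
`0 ≠ A ∈ E_𝔤(Ω₀)` then `Δ_a(U₀)↾Ω₀` is not injective on `E_𝔤(Ω₀)`. [cite: Balaban1985BackgroundPropagators, Thm 3.11 p.416, (3.27) p.395] -/
theorem not_regularAtH_of_kernel {η : ℝ} {o : OpsZd d 𝔸} {Ω₀ : Set (Site d)} {U₀ : Site d → Fin d → 𝔸ˣ} {A : Site d → Fin d → 𝔸}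
    (hA : A ∈ domSubH (𝔸 := 𝔸) Ω₀) (hA0 : A ≠ 0) (hker : deltaAOf η o U₀ A = 0) : ¬ RegularAtH η o Ω₀ U₀ := by
  rintro ⟨Φ, hΦ, hbij⟩
  have h0 : Φ ⟨A, hA⟩ = 0 := by
    apply Subtype.ext
    rw [hΦ ⟨A, hA⟩, Submodule.coe_zero]
    funext y τ
    show restrictDom Ω₀ (deltaAOf η o U₀ A) y τ = 0
    by_cases hb : BondTouches Ω₀ y τ
    · rw [restrictDom_of _ hb, hker]; rfl
    · rw [restrictDom_of_not _ hb]
  have h := hbij.1 (h0.trans (map_zero Φ).symm)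
  exact hA0 (congrArg Subtype.val h)

omit hU in
/-- the same on the `𝔸`-valued class `E(Ω₀)` (dag-n06-w4's `RegularAt`): a non-zero kernel vector in `E(Ω₀)` excludes it. [cite: Balaban1985BackgroundPropagators, Thm 3.11 p.416, (3.27) p.395] -/
theorem not_regularAt_of_kernel {η : ℝ} {o : OpsZd d 𝔸} {Ω₀ : Set (Site d)} {U₀ : Site d → Fin d → 𝔸ˣ} {A : Site d → Fin d → 𝔸}
    (hA : A ∈ domSub (𝔸 := 𝔸) Ω₀) (hA0 : A ≠ 0) (hker : deltaAOf η o U₀ A = 0) : ¬ B9Eq327GreenZd.RegularAt η o Ω₀ U₀ := by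
  rintro ⟨Φ, hΦ, hbij⟩
  have h0 : Φ ⟨A, hA⟩ = 0 := by
    apply Subtype.ext
    rw [hΦ ⟨A, hA⟩, Submodule.coe_zero]
    funext y τ
    show restrictDom Ω₀ (deltaAOf η o U₀ A) y τ = 0
    by_cases hb : BondTouches Ω₀ y τ
    · rw [restrictDom_of _ hb, hker]; rfl
    · rw [restrictDom_of_not _ hb]
  exact hA0 (congrArg Subtype.val (hbij.1 (h0.trans (map_zero Φ).symm)))

variable {L : ℕ} (τ : 𝔸 →ₗ[ℂ] ℂ) (hτt : ∀ a b : 𝔸, τ (a * b) = τ (b * a)) (hτs : ∀ a : 𝔸, τ (star a) = starRingEnd ℂ (τ a))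
  (hτp : ∀ a : 𝔸, a ≠ 0 → 0 < (τ (star a * a)).re)
variable (ΛbP : ℕ → ℕ → Set (Site d × Fin d)) (ops₀ : ℝ → ZdIdx d L → ℕ → OpsZd d 𝔸) (M : ℝ) (i : ZdIdx d L) (m : ℕ)

include hU hτs hτp in
/-- ★★★ **AT THE TWIST THE GENUINE `Δ_a(U₀)` IS SINGULAR ON `E_𝔤(Ω₀)`**: at a member with finite `Ω₀` containing the far end `z + e_ν` of the twisted bond and a
level-`0` constraint site `y₀ ∈ Λ₀` (`L ≥ 1`, `d ≥ 2` via a direction `κ ≠ ν`, faithful Hermitian `τ`), there is a Hermitian `0 ≠ A ∈ E_𝔤(Ω₀)` — the pure gauge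
`D_{U₀}λ` of §3's `λ` — with `Δ_a(U₀)A = 0` on EVERY bond; in particular `¬ RegularAtH`: Theorem 3.11's conclusion «`G = (Δ_a↾Ω₀)⁻¹` exists» FAILS at `U₀`.
[cite: Balaban1985BackgroundPropagators, Thm 3.11 p.416, (3.26)–(3.27) p.395, (3.21) p.394; Balaban1985RegularSpaces, (1.7) p.77] -/
theorem exists_kernel_twist [Nontrivial 𝔸] [FiniteDimensional ℝ 𝔸] (hL : 1 ≤ L) (hΩ : (i.Ω 0).Finite) (hx₀ : z + e ν ∈ i.Ω 0)
    {κ : Fin d} (hκ : κ ≠ ν) {y₀ : Site d} (hy₀ : y₀ ∈ i.Ω 0) (hΛ : y₀ ∈ i.Λs m 0) :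
    ∃ A ∈ domSubH (𝔸 := 𝔸) (i.Ω 0), A ≠ 0 ∧ OnDom L m i.η i.Ω A ∧ deltaAOf i.η (opsAllZd τ L ΛbP ops₀ M i m) U₀ A = 0 ∧
      deltaAOf i.η (opsAllZd τ L ΛbP ops₀ M i m) U₀ (0 : Site d → Fin d → 𝔸) = 0 := by
  obtain ⟨lam, hsa, hsupp, hlam, hproj⟩ := exists_herm_projR_covLap_eq_zero τ hτs hτp hΩ.toFinset L m i.η (i.Λs m) U₀
    (hΩ.mem_toFinset.mpr hy₀) hΛ
  have hsupp' : ∀ x, x ∉ i.Ω 0 → lam x = 0 := fun x hx => hsupp x fun h => hx (hΩ.mem_toFinset.mp h)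
  exact ⟨_, gauge_mem_domSubH z ν i.η hU hsa hsupp', gauge_ne_zero z ν i.η hU i.hη.ne' hsupp hlam,
    onDom_gauge z ν i.η hU hL m i.hη (fun x => hΩ.mem_toFinset.symm) hsa hsupp,
    deltaAOf_opsAllZd_gauge_twist_eq_zero z ν hU lam τ ΛbP ops₀ M i m hL hΩ hx₀ hκ hproj,
    deltaAOf_opsAllZd_zero_twist z ν hU τ ΛbP ops₀ M i m hL hΩ hx₀ hκ⟩

include hU hτs hτp in
/-- ★★★ hence `¬ RegularAtH` at the twist for the genuine record, and `G_𝔤(U₀)` reads its junk branch `0`. [cite: Balaban1985BackgroundPropagators, Thm 3.11 p.416, (3.27) p.395] -/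
theorem not_regularAtH_twist [Nontrivial 𝔸] [FiniteDimensional ℝ 𝔸] (hL : 1 ≤ L) (hΩ : (i.Ω 0).Finite) (hx₀ : z + e ν ∈ i.Ω 0)
    {κ : Fin d} (hκ : κ ≠ ν) {y₀ : Site d} (hy₀ : y₀ ∈ i.Ω 0) (hΛ : y₀ ∈ i.Λs m 0) :
    ¬ RegularAtH i.η (opsAllZd τ L ΛbP ops₀ M i m) (i.Ω 0) U₀ := by
  obtain ⟨A, hA, hA0, -, hker, -⟩ := exists_kernel_twist z ν hU τ hτs hτp ΛbP ops₀ M i m hL hΩ hx₀ hκ hy₀ hΛ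
  exact not_regularAtH_of_kernel hA hA0 hker

end Singular

/-! ## §2  At a cube member: the frame class (3.35) holds a SINGULAR background — the frame-keyed (3.27) binders are false -/

section Cube

variable {𝔸 : Type} [CStarAlgebra 𝔸] [Nontrivial 𝔸] [FiniteDimensional ℝ 𝔸]
variable (τ : 𝔸 →ₗ[ℂ] ℂ) (hτs : ∀ a : 𝔸, τ (star a) = starRingEnd ℂ (τ a)) (hτp : ∀ a : 𝔸, a ≠ 0 → 0 < (τ (star a * a)).re)
variable {L : ℕ} (ΛbP : ℕ → ℕ → Set (Site d × Fin d)) (ops₀ : ℝ → ZdIdx d L → ℕ → OpsZd d 𝔸)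

omit [Nontrivial 𝔸] [FiniteDimensional ℝ 𝔸] in
/-- ★ **THE LOWER CORNER OF `□₀` IS A LEVEL-`0` CONSTRAINT SITE** of the `m`-truncated cube member (`ρ ≥ 1`, `d ≥ 1`): `sqLo₀ ∈ Λ₀ = (cubeLamS …) m 0` — for `m ≥ 1` this
is `□₀ ∖ □₁` (the next traced cube starts `ρ` sites further in), for `m = 0` it is all of `□₀`. [cite: Balaban1985RegularSpaces, (1.131) p.99, (1.68) p.88, (1.5) p.77] -/
theorem corner_mem_cubeLamS_zero (hd : 1 ≤ d) (L : ℕ) (a : Site d) (Mc : ℕ) {ρ : ℕ} (hρ : 1 ≤ ρ) (k m : ℕ) :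
    sqLo L a ρ k 0 ∈ cubeLamS L a Mc ρ k m 0 := by
  have hbox : B7Prop1Local.InBox (sqLo L a ρ k 0) (sqHi L a Mc ρ k 0) (sqLo L a ρ k 0) :=
    fun i' => ⟨le_rfl, sqLo_le_sqHi_zero L a Mc hρ k i'⟩
  unfold cubeLamS
  split_ifs with hm hm0
  · refine ⟨hbox, fun _ hin => ?_⟩
    have h := (hin ⟨0, hd⟩).1
    simp only [inLo, sqLo, B8Eq131Cubes.bLo, Nat.sub_zero] at h
    have hg : 1 ≤ B8Eq131Cubes.gs L k := B8Eq131Cubes.one_le_gs L k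
    have hρ' : ((ρ * (B8Eq131Cubes.gs L k - 1) : ℕ) : ℤ) + ρ = ((ρ * B8Eq131Cubes.gs L k : ℕ) : ℤ) := by
      have : ρ * (B8Eq131Cubes.gs L k - 1) + ρ = ρ * B8Eq131Cubes.gs L k := by
        rw [Nat.mul_sub, mul_one, Nat.sub_add_cancel (Nat.le_mul_of_pos_right ρ hg)]
      exact_mod_cast this
    have hρ1 : (1 : ℤ) ≤ ρ := by exact_mod_cast hρ
    linarith
  · exact hbox
  · omega

include hτs hτp in
/-- ★★★ **INSIDE THE FRAME CLASS (3.35) OF A CUBE MEMBER THE GENUINE `Δ_a(U₀)` IS SINGULAR ON `E_𝔤(□₀)`**: at every `cubeFam false` member (`2 ≤ d`, `1 ≤ L`, `1 ≤ ρ`),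
for every frame constant `c35·M·α₀ > 0`, there are a unitary `U₀` IN the class `(bgZd …).Reg335 c35 α₀` (the crossing-bond twist at the lower corner of `□₀`) and a
Hermitian `0 ≠ A ∈ E_𝔤(□₀)` satisfying the binders' `OnDom` with `Δ_a(U₀)A = 0` on every bond for the genuine four-letter record `opsAllZd`; `¬ RegularAtH` there.
Print's Thm 3.11 is about `U` regular on cubes COVERING the plaquettes `Δ_a↾Ω₀` reads — the frame's class at a cube member is blind to the collar (dag-n06-b
g20's LOCATED-SELF-6, premise certified in `B9Eq335CollarBlindCubeZd`); this is its kernel certificate in the strongest form.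
[cite: Balaban1985BackgroundPropagators, Thm 3.11 p.416, (3.35) p.396, (3.26)–(3.27) p.395; Balaban1985RegularSpaces, (1.7) p.77, (1.33) p.82, (1.131) p.99] -/
theorem exists_reg335_not_regularAtH_cube (hd2 : 2 ≤ d) (hL : 1 ≤ L) (M : ℝ) (i : ZdIdx d L)
    {a : Site d} {Mc ρ : ℕ} (hρ : 1 ≤ ρ) (hΩ : i.Ω = cubeFam false L a Mc ρ i.k) (hΛs : i.Λs = cubeLamS L a Mc ρ i.k) (m : ℕ)
    {c35 α₀ : ℝ} (hc : 0 < c35 * M * α₀) :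
    ∃ (U₀ : Site d → Fin d → 𝔸ˣ) (hU₀ : ∀ x κ, U₀ x κ ∈ unitaryUnits 𝔸),
      (bgZd 𝔸 L (memZd M i m)).Reg335 c35 α₀ (ιCfgZd 𝔸 L M i m U₀ hU₀) ∧
        ¬ RegularAtH i.η (opsAllZd τ L ΛbP ops₀ M i m) (i.Ω 0) U₀ ∧
        ∃ A ∈ domSubH (𝔸 := 𝔸) (i.Ω 0), A ≠ 0 ∧ OnDom L m i.η i.Ω A ∧ deltaAOf i.η (opsAllZd τ L ΛbP ops₀ M i m) U₀ A = 0 ∧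
          deltaAOf i.η (opsAllZd τ L ΛbP ops₀ M i m) U₀ (0 : Site d → Fin d → 𝔸) = 0 := by
  classical
  obtain ⟨κ, ν, hκν⟩ : ∃ κ ν : Fin d, κ ≠ ν := ⟨⟨0, by omega⟩, ⟨1, by omega⟩, by simp [Fin.ext_iff]⟩
  obtain ⟨x₀, hx₀_def⟩ : ∃ x₀ : Site d, x₀ = sqLo L a ρ i.k 0 := ⟨_, rfl⟩
  have hx₀ : x₀ ∈ i.Ω 0 := by
    rw [hΩ, cubeFam_false_zero, mem_cube_zero_iff, hx₀_def]
    exact fun i' => ⟨le_rfl, sqLo_le_sqHi_zero L a Mc hρ i.k i'⟩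
  have hΛ : x₀ ∈ i.Λs m 0 := by
    rw [hΛs, hx₀_def]
    exact corner_mem_cubeLamS_zero (by omega) L a Mc hρ i.k m
  obtain ⟨z, hz_def⟩ : ∃ z : Site d, z = x₀ - e ν := ⟨_, rfl⟩
  have hz : z ∉ i.Ω 0 := by
    rw [hΩ, cubeFam_false_zero, mem_cube_zero_iff]
    intro h
    have h1 := (h ν).1
    rw [hz_def, Pi.sub_apply, B7Prop1Explicit.e_apply, if_pos rfl, hx₀_def] at h1
    linarith
  have hzx : z + e ν = x₀ := by rw [hz_def, sub_add_cancel]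
  have hfin : (i.Ω 0).Finite := B9Thm311PosDefOpenZd.cubeMember_Ω0_finite i hΩ
  obtain ⟨U₀, hU⟩ : ∃ U₀ : Site d → Fin d → 𝔸ˣ, ∀ y κ', U₀ y κ' = if y = z ∧ κ' = ν then -1 else 1 := ⟨fun y κ' => if y = z ∧ κ' = ν then -1 else 1, fun _ _ => rfl⟩
  have hU₀ : ∀ x κ', U₀ x κ' ∈ unitaryUnits 𝔸 := twist_mem_unitaryUnits z ν hU
  obtain ⟨A, hA, hA0, hon, hker, hker0⟩ := exists_kernel_twist z ν hU τ hτs hτp ΛbP ops₀ M i m hL hfin (hzx ▸ hx₀) hκν hx₀ hΛ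
  refine ⟨U₀, hU₀, ?_, not_regularAtH_of_kernel hA hA0 hker, A, hA, hA0, hon, hker, hker0⟩
  exact reg335_bgZd_of_one_on_omega hL M i m hc hU₀ fun y hy κ' => twist_of_site_ne z ν hU (fun h' => hz (h' ▸ hy)) κ'

include hτs hτp in
/-- ★★★ **THE FRAME-KEYED THEOREM 3.11 REGULARITY BINDER IS FALSE FOR THE GENUINE RECORD AT EVERY CUBE MEMBER**: for `0 < c35`, `0 < M`, `0 < a₃`,
`¬ RegularInClassAtH (bgZd 𝔸 L) memZd (ιCfgZd 𝔸 L) (opsAllZd τ L ΛbP ops₀) c35 a₃ M i m` (also for `withGopZdH (opsAllZd …)`, same `Δ_a`).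
[cite: Balaban1985BackgroundPropagators, Thm 3.11 p.416, (3.35) p.396, (3.27) p.395; Balaban1985RegularSpaces, (1.131) p.99] -/
theorem not_regularInClassAtH_opsAllZd_cube (hd2 : 2 ≤ d) (hL : 1 ≤ L) {M : ℝ} (hM : 0 < M) (i : ZdIdx d L)
    {a : Site d} {Mc ρ : ℕ} (hρ : 1 ≤ ρ) (hΩ : i.Ω = cubeFam false L a Mc ρ i.k) (hΛs : i.Λs = cubeLamS L a Mc ρ i.k) (m : ℕ)
    {c35 a₃ : ℝ} (hc35 : 0 < c35) (ha₃ : 0 < a₃) :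
    ¬ RegularInClassAtH (bgZd 𝔸 L) memZd (ιCfgZd 𝔸 L) (opsAllZd τ L ΛbP ops₀) c35 a₃ M i m := by
  intro hreg
  have hα : 0 < a₃ / M := div_pos ha₃ hM
  have hMα : M * (a₃ / M) ≤ a₃ := by rw [mul_div_cancel₀ _ hM.ne']
  have hc : 0 < c35 * M * (a₃ / M) := by rw [mul_assoc, mul_div_cancel₀ _ hM.ne']; exact mul_pos hc35 ha₃
  obtain ⟨U₀, hU₀, hR, hnot, -⟩ := exists_reg335_not_regularAtH_cube τ hτs hτp ΛbP ops₀ hd2 hL M i hρ hΩ hΛs m hc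
  exact hnot (hreg (a₃ / M) U₀ hU₀ hα hMα hR)

include hτs hτp in
/-- ★★★ **THE FRAME-KEYED (3.27) BINDER (EDITION H) IS FALSE FOR THE GENUINE `G_𝔤` AT EVERY CUBE MEMBER**: `¬ InvAtH (bgZd 𝔸 L) L memZd (ιCfgZd 𝔸 L)
(withGopZdH (opsAllZd τ L ΛbP ops₀)) c35 a₃ M i m` for `0 < c35`, `0 < M`, `0 < a₃` — at the singular class point the kernel vector `A ≠ 0` and the field `0`
have the SAME `Δ_a(U₀)`-image `0`, so (3.27) would return both as `G_𝔤(U₀)0`.  (dag-n06-b g20's repair: EDITION H·I `InvAtHI`, keyed to the datum (1.7),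
inhabited at every cube member.) [cite: Balaban1985BackgroundPropagators, (3.27) p.395, Thm 3.11 p.416, (3.35) p.396; Balaban1985RegularSpaces, (1.58) p.86, (1.33) p.82] -/
theorem not_invAtH_withGopZdH_opsAllZd_cube (hd2 : 2 ≤ d) (hL : 1 ≤ L) {M : ℝ} (hM : 0 < M) (i : ZdIdx d L)
    {a : Site d} {Mc ρ : ℕ} (hρ : 1 ≤ ρ) (hΩ : i.Ω = cubeFam false L a Mc ρ i.k) (hΛs : i.Λs = cubeLamS L a Mc ρ i.k) (m : ℕ)
    {c35 a₃ : ℝ} (hc35 : 0 < c35) (ha₃ : 0 < a₃) :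
    ¬ InvAtH (bgZd 𝔸 L) L memZd (ιCfgZd 𝔸 L) (withGopZdH (opsAllZd τ L ΛbP ops₀)) c35 a₃ M i m := by
  intro hinv
  have hα : 0 < a₃ / M := div_pos ha₃ hM
  have hMα : M * (a₃ / M) ≤ a₃ := by rw [mul_div_cancel₀ _ hM.ne']
  have hc : 0 < c35 * M * (a₃ / M) := by rw [mul_assoc, mul_div_cancel₀ _ hM.ne']; exact mul_pos hc35 ha₃
  obtain ⟨U₀, hU₀, hR, -, A, hA, hA0, hon, hker, hker0⟩ := exists_reg335_not_regularAtH_cube τ hτs hτp ΛbP ops₀ hd2 hL M i hρ hΩ hΛs m hc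
  -- (3.27) at the kernel vector and at the zero field, both with `J = 0`
  have h1 := hinv (a₃ / M) U₀ hU₀ hα hMα hR A hon hA.2 0 fun y τ' _ => by rw [deltaAOf_withGopZdH, hker]
  have hon0 : OnDom L m i.η i.Ω (0 : Site d → Fin d → 𝔸) := ⟨fun _ _ _ => rfl, 0, fun j _ b _ => by simp⟩
  have h2 := hinv (a₃ / M) U₀ hU₀ hα hMα hR 0 hon0 (fun _ _ => IsSelfAdjoint.zero 𝔸) 0 fun y τ' _ => by rw [deltaAOf_withGopZdH, hker0]
  exact hA0 (h1.symm.trans h2)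

include hτs hτp in
/-- ★★ … and for the `𝔸`-valued propagator letter `gopZd` of `opsAllZd` itself (EDITION H over the non-Hermitian `G`): FALSE as well — the argument reads only the
co-letters. [cite: Balaban1985BackgroundPropagators, (3.27) p.395, Thm 3.11 p.416] -/
theorem not_invAtH_opsAllZd_cube (hd2 : 2 ≤ d) (hL : 1 ≤ L) {M : ℝ} (hM : 0 < M) (i : ZdIdx d L)
    {a : Site d} {Mc ρ : ℕ} (hρ : 1 ≤ ρ) (hΩ : i.Ω = cubeFam false L a Mc ρ i.k) (hΛs : i.Λs = cubeLamS L a Mc ρ i.k) (m : ℕ)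
    {c35 a₃ : ℝ} (hc35 : 0 < c35) (ha₃ : 0 < a₃) :
    ¬ InvAtH (bgZd 𝔸 L) L memZd (ιCfgZd 𝔸 L) (opsAllZd τ L ΛbP ops₀) c35 a₃ M i m := by
  intro hinv
  have hα : 0 < a₃ / M := div_pos ha₃ hM
  have hMα : M * (a₃ / M) ≤ a₃ := by rw [mul_div_cancel₀ _ hM.ne']
  have hc : 0 < c35 * M * (a₃ / M) := by rw [mul_assoc, mul_div_cancel₀ _ hM.ne']; exact mul_pos hc35 ha₃
  obtain ⟨U₀, hU₀, hR, -, A, hA, hA0, hon, hker, hker0⟩ := exists_reg335_not_regularAtH_cube τ hτs hτp ΛbP ops₀ hd2 hL M i hρ hΩ hΛs m hc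
  have h1 := hinv (a₃ / M) U₀ hU₀ hα hMα hR A hon hA.2 0 fun y τ' _ => by rw [hker]
  have hon0 : OnDom L m i.η i.Ω (0 : Site d → Fin d → 𝔸) := ⟨fun _ _ _ => rfl, 0, fun j _ b _ => by simp⟩
  have h2 := hinv (a₃ / M) U₀ hU₀ hα hMα hR 0 hon0 (fun _ _ => IsSelfAdjoint.zero 𝔸) 0 fun y τ' _ => by rw [hker0]
  exact hA0 (h1.symm.trans h2)

include hτs hτp in
/-- ★★ the `𝔸`-valued editions too, at EVERY cube member (incl. `m = 0`, where dag-n06-b g18's skew-mode negative does not reach): the frame-keyed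
`RegularInClassAt` (dag-n06-w4 g2) and the junction's (3.27) binder OF RECORD `InvAt` (dag-n06-b) are FALSE for the genuine record (`0 < c35`, `0 < M`, `0 < a₃`).
[cite: Balaban1985BackgroundPropagators, (3.27) p.395, Thm 3.11 p.416, (3.35) p.396; Balaban1985RegularSpaces, (1.58) p.86] -/
theorem not_regularInClassAt_not_invAt_opsAllZd_cube (hd2 : 2 ≤ d) (hL : 1 ≤ L) {M : ℝ} (hM : 0 < M) (i : ZdIdx d L)
    {a : Site d} {Mc ρ : ℕ} (hρ : 1 ≤ ρ) (hΩ : i.Ω = cubeFam false L a Mc ρ i.k) (hΛs : i.Λs = cubeLamS L a Mc ρ i.k) (m : ℕ)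
    {c35 a₃ : ℝ} (hc35 : 0 < c35) (ha₃ : 0 < a₃) :
    ¬ B9Eq327GreenZd.RegularInClassAt (bgZd 𝔸 L) memZd (ιCfgZd 𝔸 L) (opsAllZd τ L ΛbP ops₀) c35 a₃ M i m ∧
      ¬ B9SupplySockB9P3ZdAt.InvAt (bgZd 𝔸 L) L memZd (ιCfgZd 𝔸 L) (opsAllZd τ L ΛbP ops₀) c35 a₃ M i m := by
  have hα : 0 < a₃ / M := div_pos ha₃ hM
  have hMα : M * (a₃ / M) ≤ a₃ := by rw [mul_div_cancel₀ _ hM.ne']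
  have hc : 0 < c35 * M * (a₃ / M) := by rw [mul_assoc, mul_div_cancel₀ _ hM.ne']; exact mul_pos hc35 ha₃
  obtain ⟨U₀, hU₀, hR, -, A, hA, hA0, hon, hker, hker0⟩ := exists_reg335_not_regularAtH_cube τ hτs hτp ΛbP ops₀ hd2 hL M i hρ hΩ hΛs m hc
  refine ⟨fun hreg => not_regularAt_of_kernel hA.1 hA0 hker (hreg (a₃ / M) U₀ hU₀ hα hMα hR), fun hinv => ?_⟩
  have h1 := hinv (a₃ / M) U₀ hU₀ hα hMα hR A hon 0 fun y τ' _ => by rw [hker]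
  have hon0 : OnDom L m i.η i.Ω (0 : Site d → Fin d → 𝔸) := ⟨fun _ _ _ => rfl, 0, fun j _ b _ => by simp⟩
  have h2 := hinv (a₃ / M) U₀ hU₀ hα hMα hR 0 hon0 0 fun y τ' _ => by rw [hker0]
  exact hA0 (h1.symm.trans h2)

end Cube

end Literature.MathematicalPhysics.QuantumFieldTheory.Balaban1983to89.B9Thm311SingularInFrameClassCubeZd

end
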